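import Mathlib
import HarnessLib
import Literature.Analysis.Complex.WeierstrassPreparation
import Summits.RiemannHypothesis.RiemannHypothesis.Theorems.PfPersistenceFfAngleTwin

/-!
# Function-field mirror: the DIAL BLIND PREFIX of the window tower
(pub-rhpf, seat ffmirror-2 for seat ffmirror-1; HONEST FRAMING: mechanism/rigidity campaign — no RH claims)

Companion to `PfPersistenceFfAngleTwin`.  The window form `T_M(q, h)` of a datum `(q, h)`,
`h(x) = ∏_j (x - α_j)` monic of degree `n`, is the Toeplitz matrix of `K(0), …, K(M)` with
`K(k) = s_k / (2 (√q)^k)`, `s_k = Σ_j α_j^k`.  By NEWTON'S IDENTITIES the power sums `s_1, …, s_m`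
are polynomials in the elementary symmetric functions `e_1, …, e_m` of the roots, i.e. (Vieta) in the
TOP coefficients `h_{n-1}, …, h_{n-m}`; hence (`weilWindowForm_eq_of_coeff_eq`):

* two monic integer polynomials of the same degree whose coefficients of `x^{n-1}, …, x^{n-m}` agree
  have IDENTICAL window forms `T_0, …, T_m`.

The instance that matters for the cell's function-field fakes (pub-rhpf-ffmirror-1 `FF-FAKES.md`,
lemma L1(ii), family V-DIAL): the ONE-COEFFICIENT DIAL `h ↦ h + k·x^g` of a degree-`2g` datum (in
`L`-polynomial terms `P_C(T) ↦ P_C(T) + k T^g`) changes only the middle coefficient, so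
(`weilWindowForm_dial`, `weilTowerPrefix_dial`, `prefixFunctional_eq_dial`) every window form with `M ≤ g - 1` — and therefore
every functional of the truncated tower `(T_0, …, T_{g-1})` — is IDENTICAL for the curve and for
every member of its dial, although for `|k|` large the dialled polynomial violates the Riemann
hypothesis `|α_j| = √q` (that part is DATA / elementary estimates in FF-FAKES.md, not formalised
here).  Pure algebra, [folklore]; the multiset form of Newton's identities used is
`Literature.Analysis.Complex.SCV.natCast_mul_esymm_eq_sum`.
-/

set_option linter.dupNamespace false  -- the mandated namespace repeats `RiemannHypothesis`

noncomputable section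

open Polynomial Finset

namespace Summit.RiemannHypothesis.RiemannHypothesis.Theorems.PfPersistence.FfAngleTwin

/-! ## Newton: the first `m` power sums are determined by the first `m` elementary symmetric functions -/

/-- `e_0(A) = 1`. [folklore] -/
theorem multiset_esymm_zero (A : Multiset ℂ) : A.esymm 0 = 1 := by
  simp [Multiset.esymm, Multiset.powersetCard_zero_left]

/-- NEWTON (multiset form, the direction `e ↦ s`): if `e_k(A) = e_k(A')` for `1 ≤ k ≤ m` then
`s_k(A) = s_k(A')` for `1 ≤ k ≤ m` (strong induction on `k` through
`k e_k = (-1)^{k+1} Σ_{i<k} (-1)^i e_i s_{k-i}`). [folklore] -/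
theorem powerSum_eq_of_esymm_eq {A A' : Multiset ℂ} {m : ℕ}
    (he : ∀ k, 1 ≤ k → k ≤ m → A.esymm k = A'.esymm k) :
    ∀ k, 1 ≤ k → k ≤ m → powerSum A k = powerSum A' k := by
  intro k
  induction k using Nat.strong_induction_on with
  | _ k ih =>
    intro hk1 hkm
    have h1 := Literature.Analysis.Complex.SCV.natCast_mul_esymm_eq_sum A k
    have h2 := Literature.Analysis.Complex.SCV.natCast_mul_esymm_eq_sum A' k
    rw [he k hk1 hkm, h2] at h1
    have hu : ((-1 : ℂ) ^ (k + 1)) ≠ 0 := pow_ne_zero _ (neg_ne_zero.mpr one_ne_zero)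
    have hsum := mul_left_cancel₀ hu h1
    have hmem : ((0 : ℕ), k) ∈ (antidiagonal k).filter (fun a => a.1 < k) := by
      simp only [mem_filter, HasAntidiagonal.mem_antidiagonal]; omega
    rw [← add_sum_erase _ _ hmem, ← add_sum_erase _ _ hmem] at hsum
    have hrest : ∑ a ∈ ((antidiagonal k).filter (fun a => a.1 < k)).erase (0, k),
          (-1) ^ a.1 * A'.esymm a.1 * (A'.map (· ^ a.2)).sum
        = ∑ a ∈ ((antidiagonal k).filter (fun a => a.1 < k)).erase (0, k),
          (-1) ^ a.1 * A.esymm a.1 * (A.map (· ^ a.2)).sum := by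
      refine sum_congr rfl (fun a ha => ?_)
      have ha' := ha
      rw [mem_erase, mem_filter, HasAntidiagonal.mem_antidiagonal] at ha'
      obtain ⟨hne, hak, hlt⟩ := ha'
      have ha1 : 1 ≤ a.1 := by
        rcases Nat.eq_zero_or_pos a.1 with h0 | h0
        · exact absurd (Prod.ext h0 (by simpa [h0] using hak)) hne
        · exact h0
      have hps : powerSum A a.2 = powerSum A' a.2 := ih a.2 (by omega) (by omega) (by omega)
      simp only [powerSum] at hps
      rw [he a.1 ha1 (by omega), hps]
    rw [hrest, multiset_esymm_zero, multiset_esymm_zero] at hsum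
    have h := add_right_cancel hsum
    simp only [pow_zero, one_mul] at h
    simpa [powerSum] using h.symm

/-! ## Vieta: top coefficients determine the first elementary symmetric functions of the roots -/

/-- For monic complex polynomials of the same degree `n`: if the coefficients of `x^{n-k}` agree for
`1 ≤ k ≤ m` (`k ≤ n`), then `e_k(roots) ` agree for `1 ≤ k ≤ m`. [folklore] -/
theorem esymm_roots_eq_of_coeff_eq {p p' : ℂ[X]} (hp : p.Monic) (hp' : p'.Monic)
    (hdeg : p.natDegree = p'.natDegree) {m : ℕ}
    (hc : ∀ k, 1 ≤ k → k ≤ m → k ≤ p.natDegree → p.coeff (p.natDegree - k) = p'.coeff (p.natDegree - k)) :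
    ∀ k, 1 ≤ k → k ≤ m → p.roots.esymm k = p'.roots.esymm k := by
  intro k hk1 hkm
  have hr : Multiset.card p.roots = p.natDegree := (IsAlgClosed.splits p).natDegree_eq_card_roots.symm
  have hr' : Multiset.card p'.roots = p'.natDegree :=
    (IsAlgClosed.splits p').natDegree_eq_card_roots.symm
  by_cases hkn : k ≤ p.natDegree
  · have h1 := Polynomial.coeff_eq_esymm_roots_of_card hr (k := p.natDegree - k) (Nat.sub_le _ _)
    have h2 := Polynomial.coeff_eq_esymm_roots_of_card hr' (k := p'.natDegree - k) (Nat.sub_le _ _)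
    rw [hp.leadingCoeff, Nat.sub_sub_self hkn] at h1
    rw [hp'.leadingCoeff, Nat.sub_sub_self (hdeg ▸ hkn)] at h2
    have h := hc k hk1 hkm hkn
    rw [h1, hdeg, h2] at h
    have hu : (1 : ℂ) * (-1) ^ k ≠ 0 := by
      rw [one_mul]; exact pow_ne_zero _ (neg_ne_zero.mpr one_ne_zero)
    exact mul_left_cancel₀ hu h
  · have hkn' : p.natDegree < k := not_le.mp hkn
    rw [Multiset.esymm, Multiset.powersetCard_eq_empty k (by rw [hr]; exact hkn'), Multiset.esymm,
      Multiset.powersetCard_eq_empty k (by rw [hr', ← hdeg]; exact hkn')]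

/-! ## The window forms `T_0, …, T_m` depend only on the top `m` coefficients -/

/-- `|i - j| ≤ M` for `i, j ≤ M`. [folklore] -/
theorem natDist_le_of_fin {M : ℕ} (i j : Fin (M + 1)) : Nat.dist i j ≤ M := by
  have hi := i.is_lt; have hj := j.is_lt
  unfold Nat.dist; omega

/-- The number of Frobenius roots of a monic `h` is its degree. [folklore] -/
theorem card_frobRoots {h : ℤ[X]} (hh : h.Monic) : Multiset.card (frobRoots h) = h.natDegree := by
  unfold frobRoots
  rw [← (IsAlgClosed.splits _).natDegree_eq_card_roots, hh.natDegree_map]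

/-- BLIND PREFIX (coefficient form): two monic integer polynomials of the same degree `n` whose
coefficients of `x^{n-1}, …, x^{n-m}` agree have identical window forms `T_M` for every `M ≤ m`
(at any `q`). [folklore] -/
theorem weilWindowForm_eq_of_coeff_eq (q : ℝ) {h h' : ℤ[X]} (hh : h.Monic) (hh' : h'.Monic)
    (hdeg : h.natDegree = h'.natDegree) {m : ℕ}
    (hc : ∀ k, 1 ≤ k → k ≤ m → k ≤ h.natDegree → h.coeff (h.natDegree - k) = h'.coeff (h.natDegree - k))
    {M : ℕ} (hM : M ≤ m) : weilWindowForm q h M = weilWindowForm q h' M := by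
  have hp : (h.map (Int.castRingHom ℂ)).Monic := hh.map _
  have hp' : (h'.map (Int.castRingHom ℂ)).Monic := hh'.map _
  have hdp : (h.map (Int.castRingHom ℂ)).natDegree = h.natDegree := hh.natDegree_map _
  have hdp' : (h'.map (Int.castRingHom ℂ)).natDegree = h'.natDegree := hh'.natDegree_map _
  have hes : ∀ k, 1 ≤ k → k ≤ m → (frobRoots h).esymm k = (frobRoots h').esymm k := by
    refine esymm_roots_eq_of_coeff_eq hp hp' (by rw [hdp, hdp', hdeg]) ?_
    intro k hk1 hkm hkn
    rw [hdp] at hkn ⊢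
    rw [Polynomial.coeff_map, Polynomial.coeff_map, hc k hk1 hkm hkn]
  have hps : ∀ n, n ≤ m → powerSum (frobRoots h) n = powerSum (frobRoots h') n := by
    intro n hn
    rcases Nat.eq_zero_or_pos n with h0 | h0
    · subst h0
      rw [powerSum_zero, powerSum_zero, card_frobRoots hh, card_frobRoots hh', hdeg]
    · exact powerSum_eq_of_esymm_eq hes n h0 hn
  ext i j
  simp only [weilWindowForm, ffWindowForm, Matrix.of_apply]
  rw [ffKernel_eq, ffKernel_eq, hps _ ((natDist_le_of_fin i j).trans hM)]

/-! ## The one-coefficient dial `h ↦ h + k x^g` (pub-rhpf-ffmirror-1, family V-DIAL) -/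

/-- The dialled polynomial is still monic of degree `2g` (`g < 2g`). [folklore] -/
theorem monic_dial {h : ℤ[X]} {g : ℕ} (hh : h.Monic) (hdeg : h.natDegree = 2 * g) (hg : 1 ≤ g)
    (k : ℤ) : (h + C k * X ^ g).Monic ∧ (h + C k * X ^ g).natDegree = 2 * g := by
  have hlt : (C k * X ^ g).degree < h.degree := by
    refine (degree_C_mul_X_pow_le g k).trans_lt ?_
    rw [degree_eq_natDegree hh.ne_zero, hdeg]
    exact_mod_cast (show g < 2 * g by omega)
  exact ⟨hh.add_of_left hlt, by rw [natDegree_add_eq_left_of_degree_lt hlt, hdeg]⟩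

/-- DIAL BLIND PREFIX: for a monic `h` of degree `2g` and any `k`, the data `(q, h)` and
`(q, h + k x^g)` have IDENTICAL window forms `T_M` for every `M ≤ g - 1` (the dial moves only the
coefficient of `x^g`, which first enters `s_g`). [folklore] -/
theorem weilWindowForm_dial (q : ℝ) {h : ℤ[X]} {g : ℕ} (hh : h.Monic) (hdeg : h.natDegree = 2 * g)
    (k : ℤ) {M : ℕ} (hM : M + 1 ≤ g) :
    weilWindowForm q (h + C k * X ^ g) M = weilWindowForm q h M := by
  have hg : 1 ≤ g := le_trans (Nat.le_add_left 1 M) hM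
  obtain ⟨hmon, hdeg'⟩ := monic_dial hh hdeg hg k
  refine weilWindowForm_eq_of_coeff_eq q hmon hh (by rw [hdeg', hdeg]) (m := g - 1) ?_ (by omega)
  intro j hj1 hjm hjn
  rw [hdeg'] at hjn ⊢
  rw [coeff_add, coeff_C_mul_X_pow, if_neg (by omega), add_zero]

/-- DIAL BLIND PREFIX (tower form): the truncated towers `(T_0, …, T_{g-1})` of `(q, h)` and
`(q, h + k x^g)` coincide (as dependent functions on `Fin g`). [folklore] -/
theorem weilTowerPrefix_dial (q : ℝ) {h : ℤ[X]} {g : ℕ} (hh : h.Monic) (hdeg : h.natDegree = 2 * g)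
    (k : ℤ) : (fun M : Fin g => weilWindowTower q (h + C k * X ^ g) M.val)
      = (fun M : Fin g => weilWindowTower q h M.val) := by
  funext M
  exact weilWindowForm_dial q hh hdeg k (M := M.val) M.is_lt

/-- … hence every functional of the first `g` window forms agrees on the curve and on every member
of its dial. [folklore] -/
theorem prefixFunctional_eq_dial {β : Sort*} {g : ℕ}
    (Φ : ((M : Fin g) → Matrix (Fin (M.val + 1)) (Fin (M.val + 1)) ℂ) → β)
    (q : ℝ) {h : ℤ[X]} (hh : h.Monic) (hdeg : h.natDegree = 2 * g) (k : ℤ) :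
    Φ (fun M : Fin g => weilWindowTower q (h + C k * X ^ g) M.val)
      = Φ (fun M : Fin g => weilWindowTower q h M.val) := by
  rw [weilTowerPrefix_dial q hh hdeg k]

end Summit.RiemannHypothesis.RiemannHypothesis.Theorems.PfPersistence.FfAngleTwin

end
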